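import Mathlib
import Literature.Combinatorics.Optimization.CorrelationPolytopeGridMinor
import Literature.Computability.MetaComplexity.GridTseitinLift
import Literature.Computability.AlgebraicComplexity.NestFreeMatchingPoly
import Summits.ValiantsHypothesis.ValiantsHypothesis.Theorems.FifoMatchingGridCorShadowFaceLift
import Summits.ValiantsHypothesis.ValiantsHypothesis.Theorems.FifoMatchingGridCorShadowCliqueParabola
import Summits.ValiantsHypothesis.ValiantsHypothesis.Theorems.FifoMatchingGridCorShadowCoordinateFace
import Summits.ValiantsHypothesis.ValiantsHypothesis.Theorems.FifoMatchingGridCorShadowZeroOnePoints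
import Summits.ValiantsHypothesis.ValiantsHypothesis.Theorems.FifoMatchingNFPolytopeQueueGridCorProjection
import Summits.ValiantsHypothesis.ValiantsHypothesis.Theses.FifoMatching
import HarnessLib

/-!
# The shadow line with the bound left FREE (file 1 of 2 of the exponential rung): G♭ ⇒ G, T1, T2 as vertex COUNTS

Port to `Theorems/` (director-valiant g13 R207 (a), val-lit desk l.7909: val-port-2 g1 = F9, split in two files by the 400-line
norm) of § ExpRung, first half, of val-idea-7 g7's kernel-checked line workfile
`Cruxes/NNLinearDegreeCofactorHard/Lines/shadow_division.lean` rev 10 @b49724032a2a (l.1879–2000: `gridCor_count`, `pp_count`,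
`nfp_count`), verbatim bodies, with NO definitions (crit-3 #21b port note (a)): the line's `shadowVerts` is UNFOLDED to
`(Set.extremePoints ℝ (convexHull ℝ (L '' S))).ncard`, G♭ is the route decl `Theses.FifoMatching.GridCorCliqueFace` (stmt-27045,
CLOSED p622413) BY NAME, and A1 is the landed `GridCorShadow.queueGridZeroOnePoints_holds` (p622527, val-port-4 g1).  These are
the three transfers of the shadow line (F3 «G♭ ⇒ G» p620696, F4 T1 p620830, F6 T2 p622205) re-run with the vertex bound `B` as a
free parameter instead of the route threshold `2^((log₂ · + c)^c)`, so that the second file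
(`…GridCorShadowExpRung.lean`) can feed in an EXPONENTIAL bound.

* `gridCor_count` — G♭ ⇒ G: for `t ≥ t₀` there is `h ≥ c₀·t` such that every `B` with `4B < 2^h` is exceeded by the hull-vertex
  count of some planar shadow of `range (corVec (gridGraph t))` (F2 `convexHull_inter_face`, F2 `clique_parabola_shadow` =
  HY21 Prop 19, F1 `shadow_faceLift_count_face` = HY21 Lemma 10).
* `pp_count` — T1: the pull-back along c1's `corMap r ⌊r/2⌋` (`range_corMap_patternVec`, p615220) keeps the bound.
* `nfp_count` — T2: the face lift along A1's located coordinate face costs a factor `4` (F6 `sumCoord_face` /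
  `suppPts_coord_dichotomy`, F1 `shadow_faceLift_count`), `r = ⌊√n⌋/2 − 1`.

HONEST FRAMING: helper layer (`--supports stmt-ValiantsHypothesis-27271` until tenure g12 files the record rung
`NNExpDegreeCofactorHard`); 27045 is CLOSED, A1 is a theorem, so these counts are unconditional in use; R2 stmt-27271 closes on
val-port-4 g1's 1-liner; stmt-21181 OPEN; nothing here is a summit statement or bears on `VP ≠ VNP`, which is NOT proved.

Sources: [HrubesYehudayoff2021: Lemma 10 p.7, Prop 19 p.10]; [AboulkerEtAl2019, arXiv:1806.00541 pp. 5–6].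
-/

set_option autoImplicit false

-- the mandated summit-side namespace repeats a component by design (single-problem summit)
set_option linter.dupNamespace false

noncomputable section

namespace Summit.ValiantsHypothesis.ValiantsHypothesis.Theorems.FifoMatching

namespace GridCorShadow

open scoped NNReal
open Matrix MvPolynomial
open Literature.Computability.AlgebraicComplexity
open Literature.Combinatorics.Optimization (corVec corPolytopeGraph)
open Literature.Computability.MetaComplexity (gridGraph)
open Summit.ValiantsHypothesis.ValiantsHypothesis.Theorems.FifoMatching.QueueGridFace
  (realOf suppPts QGV patternVec corVertex corMap range_corMap_patternVec corVec_eq_corVertex)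
open Summit.ValiantsHypothesis.ValiantsHypothesis.Theses.FifoMatching (GridCorCliqueFace)

/-! ## The three counts: G♭ ⇒ G, T1, T2 with the bound left free -/

/-- **G-count** (G♭ ⇒ G with the bound left free): from the route item `GridCorCliqueFace` (stmt-27045, by name), for
`t ≥ t₀` there is `h ≥ c₀·t` such that every `B` with `4B < 2^h` is exceeded by the hull-vertex count of some planar linear
shadow of the vertex set `range (corVec (gridGraph t))` of `COR(G_{t,t})`: the summed valid inequality cuts out the clique
face, its read-out has hull `COR(K_h)` (`convexHull_inter_face`), whose parabola shadow has `2^h` vertices (HY21 Prop 19,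
`clique_parabola_shadow`), and the face lift realises a quarter of them (`shadow_faceLift_count_face`, HY21 Lemma 10).
[AboulkerEtAl2019 pp. 5–6; HrubesYehudayoff2021 Prop. 19, Lemma 10] -/
theorem gridCor_count (hF : GridCorCliqueFace) :
    ∃ c₀ : ℝ, 0 < c₀ ∧ ∃ t₀ : ℕ, ∀ t ≥ t₀, ∃ h : ℕ, c₀ * t ≤ h ∧
      ∀ B : ℕ, 4 * B < 2 ^ h → ∃ L : ((Fin (t * t) × Fin (t * t)) → ℝ) →ₗ[ℝ] (Fin 2 → ℝ),
        B < (Set.extremePoints ℝ (convexHull ℝ (L '' Set.range (corVec (gridGraph t))))).ncard := by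
  classical
  obtain ⟨c₀, hc₀, t₀, hF⟩ := hF
  refine ⟨c₀, hc₀, t₀, fun t ht => ?_⟩
  obtain ⟨h, hh, k, cv, δ, π, hvalid, hface⟩ := hF t ht
  refine ⟨h, hh, fun B hB4 => ?_⟩
  set S : Set (Fin (t * t) × Fin (t * t) → ℝ) := Set.range (corVec (gridGraph t)) with hSdef
  have hP : corPolytopeGraph (gridGraph t) = convexHull ℝ S := rfl
  have hSfin : S.Finite := Set.finite_range _
  -- the summed valid inequality `w x ≤ w₀` (a proof-local structure, not a declaration) and its face
  let w : (Fin (t * t) × Fin (t * t) → ℝ) →ₗ[ℝ] ℝ :=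
    { toFun := fun x => ∑ i, cv i ⬝ᵥ x
      map_add' := fun x y => by simp [dotProduct_add, Finset.sum_add_distrib]
      map_smul' := fun a x => by simp [dotProduct_smul, Finset.mul_sum, smul_eq_mul] }
  have hw : ∀ x, w x = ∑ i, cv i ⬝ᵥ x := fun x => rfl
  let w₀ : ℝ := ∑ i, δ i
  have hvalidP : ∀ x ∈ convexHull ℝ S, w x ≤ w₀ := fun x hx => by
    rw [hw]
    exact Finset.sum_le_sum fun i _ => hvalid i x (hP ▸ hx)
  have hvalidS : ∀ x ∈ S, w x ≤ w₀ := fun x hx => hvalidP x (subset_convexHull ℝ S hx)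
  have htight : ∀ x ∈ convexHull ℝ S, ((∀ i, cv i ⬝ᵥ x = δ i) ↔ w x = w₀) := by
    intro x hx
    rw [hw]
    constructor
    · intro hall; exact Finset.sum_congr rfl fun i _ => hall i
    · intro hsum i
      have := (Finset.sum_eq_sum_iff_of_le (fun i _ => hvalid i x (hP ▸ hx))).1 hsum
      exact this i (Finset.mem_univ i)
  -- the face read-out `Y` and its hull `= COR(K_h)`
  set Y : Set (Fin h × Fin h → ℝ) := π '' (S ∩ {x | w x = w₀}) with hYdef
  have hconvY : convexHull ℝ Y = corPolytopeGraph (⊤ : SimpleGraph (Fin h)) := by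
    rw [← hface, hP]
    have hE : convexHull ℝ S ∩ {x | ∀ i, cv i ⬝ᵥ x = δ i} = convexHull ℝ S ∩ {x | w x = w₀} := by
      ext x; constructor
      · rintro ⟨hx, hall⟩; exact ⟨hx, (htight x hx).1 hall⟩
      · rintro ⟨hx, hw'⟩; exact ⟨hx, (htight x hx).2 hw'⟩
    rw [hE, convexHull_inter_face S w w₀ hvalidS, LinearMap.image_convexHull]
  -- the parabola shadow of `Y` has `2^h` vertices (HY21 Prop 19)
  obtain ⟨Λ, hΛ⟩ := clique_parabola_shadow h
  have hcount : (Set.extremePoints ℝ (convexHull ℝ (Λ '' Y))).ncard = 2 ^ h := by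
    have : convexHull ℝ (Λ '' Y) =
        convexHull ℝ (Λ '' Set.range (corVec (⊤ : SimpleGraph (Fin h)))) := by
      rw [← LinearMap.image_convexHull, hconvY, corPolytopeGraph, LinearMap.image_convexHull]
    rw [this]; exact hΛ
  have hB : 4 * B < (Set.extremePoints ℝ (convexHull ℝ (Λ '' Y))).ncard := by
    rw [hcount]; exact hB4
  obtain ⟨L, hL⟩ := shadow_faceLift_count_face S hSfin w w₀ hvalidS π Y rfl Λ B hB
  exact ⟨L, hL⟩

/-- **T1-count**: the pull-back of shadows along c1's linear read-out `corMap r ⌊r/2⌋ : PP_r ↠ COR(G_{⌊r/2⌋})` (same polygon,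
`range_corMap_patternVec`) keeps the bound. -/
theorem pp_count {c₀ : ℝ} {t₀ : ℕ}
    (hG : ∀ t ≥ t₀, ∃ h : ℕ, c₀ * t ≤ h ∧ ∀ B : ℕ, 4 * B < 2 ^ h →
      ∃ L : ((Fin (t * t) × Fin (t * t)) → ℝ) →ₗ[ℝ] (Fin 2 → ℝ),
        B < (Set.extremePoints ℝ (convexHull ℝ (L '' Set.range (corVec (gridGraph t))))).ncard)
    (r : ℕ) (hr : 2 * t₀ + 2 ≤ r) :
    ∃ h : ℕ, c₀ * ((r / 2 : ℕ) : ℝ) ≤ h ∧ ∀ B : ℕ, 4 * B < 2 ^ h →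
      ∃ Λ : (((QGV r × QGV r) × Bool × Bool) → ℝ) →ₗ[ℝ] (Fin 2 → ℝ),
        B < (Set.extremePoints ℝ (convexHull ℝ (Λ '' Set.range (patternVec r)))).ncard := by
  have hg : 2 * (r / 2) ≤ r := Nat.mul_div_le r 2
  have hgt : t₀ ≤ r / 2 := by omega
  obtain ⟨h, hh, hc⟩ := hG (r / 2) hgt
  refine ⟨h, hh, fun B hB => ?_⟩
  obtain ⟨L, hL⟩ := hc B hB
  refine ⟨L ∘ₗ corMap r (r / 2) hg, ?_⟩
  have hcv : Set.range (corVec (gridGraph (r / 2))) = Set.range (corVertex (gridGraph (r / 2))) :=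
    congrArg Set.range (funext (corVec_eq_corVertex (gridGraph (r / 2))))
  have himg : (L ∘ₗ corMap r (r / 2) hg) '' Set.range (patternVec r) =
      L '' Set.range (corVec (gridGraph (r / 2))) := by
    rw [hcv, LinearMap.coe_comp, Set.image_comp, ← Set.range_comp,
      show Set.range (⇑(corMap r (r / 2) hg) ∘ patternVec r) = Set.range (corVertex (gridGraph (r / 2))) from
        range_corMap_patternVec r (r / 2) hg]
  rw [himg]
  exact hL

/-- **T2-count**: the face lift along A1's located coordinate face (`queueGridZeroOnePoints_holds`) costs a factor `4` in
the bound (`r = ⌊√n⌋/2 − 1`). -/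
theorem nfp_count {c₀ : ℝ} {r₀ : ℕ}
    (hP : ∀ r ≥ r₀, ∃ h : ℕ, c₀ * ((r / 2 : ℕ) : ℝ) ≤ h ∧ ∀ B : ℕ, 4 * B < 2 ^ h →
      ∃ Λ : (((QGV r × QGV r) × Bool × Bool) → ℝ) →ₗ[ℝ] (Fin 2 → ℝ),
        B < (Set.extremePoints ℝ (convexHull ℝ (Λ '' Set.range (patternVec r)))).ncard)
    (n : ℕ) (hn : 4 * (max (r₀ + 1) 3) ^ 2 ≤ n) :
    ∃ h : ℕ, c₀ * ((((Nat.sqrt n / 2 - 1) / 2 : ℕ)) : ℝ) ≤ h ∧ ∀ B : ℕ, 16 * B < 2 ^ h →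
      ∃ L : ((Fin (2 * n) × Fin (2 * n)) → ℝ) →ₗ[ℝ] (Fin 2 → ℝ),
        B < (Set.extremePoints ℝ (convexHull ℝ (L '' suppPts (nestFreeMatchingPoly n ℝ≥0)))).ncard := by
  classical
  set M := max (r₀ + 1) 3 with hM
  have hM3 : 3 ≤ M := le_max_right _ _
  have hMr : r₀ + 1 ≤ M := le_max_left _ _
  set s := Nat.sqrt n with hs
  have hsM : 2 * M ≤ s := by
    rw [hs, Nat.le_sqrt]
    nlinarith [hn]
  set r := s / 2 - 1 with hr
  have hr2 : 2 ≤ r := by omega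
  have hr1 : 1 ≤ r := by omega
  have hrr₀ : r₀ ≤ r := by omega
  have hr_s : r + 1 = s / 2 := by omega
  have hss : s * s ≤ n := Nat.sqrt_le n
  have hface : (r + 1) * (2 * r + 1) ≤ n := by
    have h2 : 2 * (s / 2) ≤ s := Nat.mul_div_le s 2
    calc (r + 1) * (2 * r + 1) ≤ (r + 1) * (2 * (r + 1)) := Nat.mul_le_mul_left _ (by omega)
      _ = (s / 2) * (2 * (s / 2)) := by rw [hr_s]
      _ ≤ (s / 2) * s := Nat.mul_le_mul_left _ h2
      _ ≤ s * s := Nat.mul_le_mul_right _ (Nat.div_le_self s 2)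
      _ ≤ n := hss
  obtain ⟨Z, f, hZf⟩ := queueGridZeroOnePoints_holds r n hr1 hface
  obtain ⟨h, hh, hc⟩ := hP r hrr₀
  refine ⟨h, hh, fun B hB => ?_⟩
  obtain ⟨Λ, hΛ⟩ := hc (4 * B) (by rw [show 4 * (4 * B) = 16 * B by ring]; exact hB)
  have hSfin : (suppPts (nestFreeMatchingPoly n ℝ≥0)).Finite := (Finset.finite_toSet _).image _
  obtain ⟨hψS, hset⟩ := sumCoord_face (suppPts (nestFreeMatchingPoly n ℝ≥0)) (suppPts_coord_dichotomy _) Z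
  have hY : (LinearMap.funLeft ℝ ℝ f) ''
      (suppPts (nestFreeMatchingPoly n ℝ≥0) ∩
        {x | (∑ a ∈ Z, LinearMap.proj a : ((Fin (2 * n) × Fin (2 * n)) → ℝ) →ₗ[ℝ] ℝ) x = 0}) =
      Set.range (patternVec r) := by
    rw [hset]; exact hZf
  exact shadow_faceLift_count (suppPts (nestFreeMatchingPoly n ℝ≥0)) hSfin _ hψS (LinearMap.funLeft ℝ ℝ f)
    (Set.range (patternVec r)) hY Λ B hΛ

end GridCorShadow

end Summit.ValiantsHypothesis.ValiantsHypothesis.Theorems.FifoMatching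

end
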